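import Summits.QuantumFields.YangMills.Theorems.F4SubCurvatureDoorLaplaceFourierRegistered
import Mathlib
import HarnessLib

/-!
# LINE g21-B «fibre dichotomy» (crux ⟨stmt-QuantumFields-23125⟩ `RationalToGeneral`): rungs R-B5a `AxisBudget`, R-B4c `AxisDomination`,
# R-B4d `ShortRootCovering` BY NAME

Free-hands work of width seat `ym-line-sfw-p2-w3` (g37, cell `ym-idea-1`) on the OWNER's typed menu (ym-idea-3 g21, 2026-08-29T11:50:16Z;
rungs file `Cruxes/RationalToGeneral/Lines/fibre_dichotomy_rungs.lean` 7031e7b4ae186557, critic idea-crit-4 g9 STAMP 11:55:42Z).  The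
vocabulary `spacePart`, `lfEval`, `IsD4Isometry` and the three Props are restated CHARACTER-FOR-CHARACTER; proofs:

* `axisBudget_holds : AxisBudget` — the fifth conjunct of `InClass` (`‖x‖⁸K → 0` at `0`) read at `x = (t, 0⃗)`, `‖(t,0⃗)‖ = t`, where the
  Laplace–Fourier representation `IsLF` gives `K(t, 0⃗) = ∫ e^{−tE} dμ`;
* `axisDomination_holds : AxisDomination` — `|cos| ≤ 1`;
* `shortRootCovering_holds : ShortRootCovering` — the 24-cell covers `S³` with angular radius `45°`: if the largest coordinate has
  `|x_{i₀}| ≥ ‖x‖/√2` a coordinate TRANSPOSITION does it; otherwise `xᵢ² ≤ |xᵢ|‖x‖/√2` for all `i`, so `Σ|xᵢ| ≥ √2‖x‖`, and the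
  `D₄`-isometry (HADAMARD/2) ∘ (sign flips) has time component `Σ|xᵢ|/2 ≥ ‖x‖/√2` (the owner's CHECK 11:50:38Z).

HONEST LABEL: rungs (provable targets) of an OPEN line; nothing of B4/B5/⟨23125⟩/⟨23035⟩/R2d is proved; the Yang–Mills mass gap is NOT
proved by this file.
-/

set_option autoImplicit false

noncomputable section

namespace Summit.QuantumFields.YangMills.Theorems.F4SubCurvatureDoorFibreDichotomyAxis

open scoped Topology BigOperators
open Filter Set MeasureTheory
open Literature.MathematicalPhysics.QuantumLattice (siteToE siteToE_apply)
open Summit.QuantumFields.YangMills.Theorems.F4SubCurvatureDoorLaplaceFourierRegistered (E4 E3 InClass timeSpace IsLF)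

/-! ## Vocabulary (verbatim from `Lines/fibre_dichotomy.lean` / `fibre_dichotomy_rungs.lean`) -/

/-- The spatial part `x⃗` of a Euclidean point (verbatim from the skeleton). -/
def spacePart (x : E4) : E3 := (WithLp.equiv 2 (Fin 3 → ℝ)).symm (fun j : Fin 3 => x j.succ)

/-- LAPLACE–FOURIER EVALUATION of a measure at a Euclidean point, time read as `|x₀|` (verbatim from the skeleton). -/
def lfEval (ν : Measure (ℝ × E3)) (x : E4) : ℝ :=
  ∫ p : ℝ × E3, Real.exp (-(|x 0| * p.1)) * Real.cos (inner ℝ p.2 (spacePart x)) ∂ν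

/-- `R` preserves the even lattice `D₄` (verbatim from the skeleton). -/
def IsD4Isometry (R : E4 ≃ₗᵢ[ℝ] E4) : Prop :=
  ∀ z : Fin 4 → ℤ, Even (∑ i, z i) → ∃ w : Fin 4 → ℤ, Even (∑ i, w i) ∧ R (siteToE z) = siteToE w

/-- R-B4c «AXIS DOMINATION» (S): `|lfEval ν x| ≤ lfEval ν (|x₀| e₀) = ∫ e^{−|x₀| E} dν`. [problem-side rung] -/
def AxisDomination : Prop :=
  ∀ (ν : Measure (ℝ × E3)) (x : E4), x 0 ≠ 0 →
    (∀ t : ℝ, 0 < t → Integrable (fun p : ℝ × E3 => Real.exp (-(t * p.1))) ν) →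
    |lfEval ν x| ≤ lfEval ν (timeSpace |x 0| 0)

/-- R-B4d «SHORT-ROOT COVERING» (S–M): the 24-cell covers the sphere with angular radius 45°. [problem-side rung] -/
def ShortRootCovering : Prop :=
  ∀ x : E4, ∃ R : E4 ≃ₗᵢ[ℝ] E4, IsD4Isometry R ∧ ‖x‖ / Real.sqrt 2 ≤ |(R x) 0|

/-- R-B5a «AXIS BUDGET» (S): the fifth conjunct of `InClass` read on the time axis through the Laplace–Fourier measure. [problem-side rung] -/
def AxisBudget : Prop :=
  ∀ (K : E4 → ℝ) (μ : Measure (ℝ × E3)), InClass K → IsLF K μ →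
    Tendsto (fun t : ℝ => t ^ 8 * ∫ p : ℝ × E3, Real.exp (-(t * p.1)) ∂μ) (𝓝[>] 0) (𝓝 0)

/-! ## Coordinates of `timeSpace` -/

/-- Time coordinate of `(t, z⃗)`. -/
theorem timeSpace_zero (t : ℝ) (z : E3) : (timeSpace t z) 0 = t := by simp [timeSpace]

/-- Space part of `(t, z⃗)`. -/
theorem spacePart_timeSpace (t : ℝ) (z : E3) : spacePart (timeSpace t z) = z := by
  ext j; simp [spacePart, timeSpace]

/-- `‖(t, 0⃗)‖ = |t|`. -/
theorem norm_timeSpace_zero (t : ℝ) : ‖timeSpace t 0‖ = |t| := by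
  rw [EuclideanSpace.norm_eq, Fin.sum_univ_succ]
  simp [timeSpace, Real.sqrt_sq_eq_abs]

/-! ## R-B5a: the axis budget -/

/-- **R-B5a `AxisBudget`** BY NAME. -/
theorem axisBudget_holds : AxisBudget := by
  intro K μ hK hLF
  obtain ⟨-, -, -, -, hbudget, -⟩ := hK
  obtain ⟨-, -, hrep⟩ := hLF
  rw [Metric.tendsto_nhdsWithin_nhds] at hbudget ⊢
  intro ε hε
  obtain ⟨δ, hδ, h⟩ := hbudget ε hε
  refine ⟨δ, hδ, fun t ht hdist => ?_⟩
  have ht0 : 0 < t := ht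
  have hne : timeSpace t 0 ≠ 0 := by
    intro h0
    have := congrArg (fun v : E4 => v 0) h0
    rw [timeSpace_zero] at this
    simp at this
    exact ht0.ne' this
  have hx := h hne (by rw [dist_zero_right, norm_timeSpace_zero, abs_of_pos ht0]; simpa [dist_zero_right, abs_of_pos ht0] using hdist)
  rw [norm_timeSpace_zero, abs_of_pos ht0, hrep t 0 ht0] at hx
  simpa [inner_zero_right, Real.cos_zero] using hx

/-! ## R-B4c: axis domination -/

/-- **R-B4c `AxisDomination`** BY NAME. -/
theorem axisDomination_holds : AxisDomination := by
  intro ν x hx hint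
  have hpos : 0 < |x 0| := abs_pos.2 hx
  rw [lfEval, lfEval, spacePart_timeSpace, timeSpace_zero, abs_abs]
  simp only [inner_zero_right, Real.cos_zero, mul_one]
  have h := norm_integral_le_of_norm_le (hint _ hpos)
    (Eventually.of_forall fun p => show ‖Real.exp (-(|x 0| * p.1)) * Real.cos (inner ℝ p.2 (spacePart x))‖ ≤
      Real.exp (-(|x 0| * p.1)) from by
        rw [norm_mul, Real.norm_eq_abs, Real.norm_eq_abs, abs_of_pos (Real.exp_pos _)]
        exact mul_le_of_le_one_right (Real.exp_pos _).le (Real.abs_cos_le_one _))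
  rw [Real.norm_eq_abs] at h
  exact h

/-! ## R-B4d: the 24-cell covers the sphere with angular radius `45°` -/

/-- The point `(a, b, c, d)`. -/
def mk4 (a b c d : ℝ) : E4 := (WithLp.equiv 2 (Fin 4 → ℝ)).symm ![a, b, c, d]

/-- Coordinate `0` of `mk4`. -/
@[simp] theorem mk4_zero (a b c d : ℝ) : mk4 a b c d 0 = a := by simp [mk4]
/-- Coordinate `1` of `mk4`. -/
@[simp] theorem mk4_one (a b c d : ℝ) : mk4 a b c d 1 = b := by simp [mk4]
/-- Coordinate `2` of `mk4`. -/
@[simp] theorem mk4_two (a b c d : ℝ) : mk4 a b c d 2 = c := by simp [mk4]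
/-- Coordinate `3` of `mk4`. -/
@[simp] theorem mk4_three (a b c d : ℝ) : mk4 a b c d 3 = d := by simp [mk4]

/-- The Hadamard map divided by `2`, as a linear map. -/
def hadLin : E4 →ₗ[ℝ] E4 where
  toFun x := mk4 ((x 0 + x 1 + x 2 + x 3) / 2) ((x 0 + x 1 - x 2 - x 3) / 2) ((x 0 - x 1 + x 2 - x 3) / 2)
    ((x 0 - x 1 - x 2 + x 3) / 2)
  map_add' x y := by
    ext i; fin_cases i <;> simp <;> ring
  map_smul' a x := by
    ext i; fin_cases i <;> simp <;> ring

/-- `hadLin` is an involution. -/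
theorem hadLin_involutive : Function.Involutive hadLin := by
  intro x
  ext i
  fin_cases i <;> simp [hadLin] <;> ring

/-- `hadLin` preserves norms. -/
theorem norm_hadLin (x : E4) : ‖hadLin x‖ = ‖x‖ := by
  have h : ‖hadLin x‖ ^ 2 = ‖x‖ ^ 2 := by
    rw [EuclideanSpace.real_norm_sq_eq, EuclideanSpace.real_norm_sq_eq, Fin.sum_univ_four, Fin.sum_univ_four]
    simp [hadLin]
    ring
  nlinarith [norm_nonneg (hadLin x), norm_nonneg x]

/-- The HADAMARD/2 isometry `x ↦ ½(Σxᵢ, x₀+x₁−x₂−x₃, x₀−x₁+x₂−x₃, x₀−x₁−x₂+x₃)`. -/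
def hadIso : E4 ≃ₗᵢ[ℝ] E4 :=
  LinearIsometryEquiv.mk (LinearEquiv.ofInvolutive hadLin hadLin_involutive) norm_hadLin

/-- Time component of the Hadamard isometry. -/
theorem hadIso_zero (x : E4) : (hadIso x) 0 = (x 0 + x 1 + x 2 + x 3) / 2 := by
  simp [hadIso, hadLin]

/-- The Hadamard isometry preserves the checkerboard lattice `D₄`. -/
theorem isD4Isometry_hadIso : IsD4Isometry hadIso := by
  intro z hz
  obtain ⟨m, hm⟩ := hz
  -- integer images: every row sum has the parity of `Σ z`, hence is even
  refine ⟨![(z 0 + z 1 + z 2 + z 3) / 2, (z 0 + z 1 - z 2 - z 3) / 2, (z 0 - z 1 + z 2 - z 3) / 2,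
    (z 0 - z 1 - z 2 + z 3) / 2], ?_, ?_⟩
  · have hs : z 0 + z 1 + z 2 + z 3 = m + m := by rw [← hm, Fin.sum_univ_four]
    rw [Fin.sum_univ_four]
    simp only [Matrix.cons_val_zero, Matrix.cons_val_one, Matrix.cons_val]
    have e0 : (z 0 + z 1 + z 2 + z 3) / 2 = m := by omega
    have e1 : (z 0 + z 1 - z 2 - z 3) / 2 = m - z 2 - z 3 := by omega
    have e2 : (z 0 - z 1 + z 2 - z 3) / 2 = m - z 1 - z 3 := by omega
    have e3 : (z 0 - z 1 - z 2 + z 3) / 2 = m - z 1 - z 2 := by omega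
    rw [e0, e1, e2, e3]
    exact ⟨2 * m - z 1 - z 2 - z 3, by ring⟩
  · have hs : z 0 + z 1 + z 2 + z 3 = m + m := by rw [← hm, Fin.sum_univ_four]
    have e0 : ((z 0 + z 1 + z 2 + z 3) / 2 : ℤ) * 2 = z 0 + z 1 + z 2 + z 3 := by omega
    have e1 : ((z 0 + z 1 - z 2 - z 3) / 2 : ℤ) * 2 = z 0 + z 1 - z 2 - z 3 := by omega
    have e2 : ((z 0 - z 1 + z 2 - z 3) / 2 : ℤ) * 2 = z 0 - z 1 + z 2 - z 3 := by omega
    have e3 : ((z 0 - z 1 - z 2 + z 3) / 2 : ℤ) * 2 = z 0 - z 1 - z 2 + z 3 := by omega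
    ext i
    fin_cases i <;> simp [hadIso, hadLin, siteToE_apply]
    · have := congrArg (fun n : ℤ => (n : ℝ)) e0; push_cast at this; linarith
    · have := congrArg (fun n : ℤ => (n : ℝ)) e1; push_cast at this; linarith
    · have := congrArg (fun n : ℤ => (n : ℝ)) e2; push_cast at this; linarith
    · have := congrArg (fun n : ℤ => (n : ℝ)) e3; push_cast at this; linarith

/-- Sign flips `xᵢ ↦ ±xᵢ` (a Boolean pattern `s`, `true` = keep). -/
def signIso (s : Fin 4 → Bool) : E4 ≃ₗᵢ[ℝ] E4 :=
  LinearIsometryEquiv.piLpCongrRight 2 fun i : Fin 4 =>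
    if s i then LinearIsometryEquiv.refl ℝ ℝ else LinearIsometryEquiv.neg ℝ

/-- Coordinates of a sign flip. -/
theorem signIso_apply (s : Fin 4 → Bool) (x : E4) (i : Fin 4) :
    (signIso s x) i = if s i then x i else -x i := by
  simp only [signIso, LinearIsometryEquiv.piLpCongrRight_apply, PiLp.toLp_apply]
  split_ifs <;> rfl

/-- Sign flips preserve `D₄`. -/
theorem isD4Isometry_signIso (s : Fin 4 → Bool) : IsD4Isometry (signIso s) := by
  intro z hz
  refine ⟨fun i => if s i then z i else -z i, ?_, ?_⟩
  · have hdiff : Even (∑ i, (if s i then z i else -z i) - ∑ i, z i) := by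
      rw [← Finset.sum_sub_distrib]
      refine Finset.even_sum _ fun i _ => ?_
      split_ifs
      · simp
      · rw [show -z i - z i = -(2 * z i) by ring]; exact (even_two_mul _).neg
    exact (Int.even_sub.1 hdiff).2 hz
  · ext i
    rw [signIso_apply, siteToE_apply, siteToE_apply]
    split_ifs <;> push_cast <;> rfl

/-- Coordinate permutations. -/
def permIso (σ : Equiv.Perm (Fin 4)) : E4 ≃ₗᵢ[ℝ] E4 := LinearIsometryEquiv.piLpCongrLeft 2 ℝ ℝ σ

/-- Coordinates of a permuted point. -/
theorem permIso_apply (σ : Equiv.Perm (Fin 4)) (x : E4) (i : Fin 4) : (permIso σ x) i = x (σ.symm i) := by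
  simp [permIso, LinearIsometryEquiv.piLpCongrLeft_apply]

/-- Coordinate permutations preserve `D₄`. -/
theorem isD4Isometry_permIso (σ : Equiv.Perm (Fin 4)) : IsD4Isometry (permIso σ) := by
  intro z hz
  refine ⟨fun i => z (σ.symm i), ?_, ?_⟩
  · rwa [Equiv.sum_comp σ.symm (fun i => z i)]
  · ext i
    rw [permIso_apply, siteToE_apply, siteToE_apply]

/-- `D₄`-isometries compose. -/
theorem IsD4Isometry.trans {R S : E4 ≃ₗᵢ[ℝ] E4} (hR : IsD4Isometry R) (hS : IsD4Isometry S) :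
    IsD4Isometry (R.trans S) := by
  intro z hz
  obtain ⟨w, hw, hRw⟩ := hR z hz
  obtain ⟨v, hv, hSv⟩ := hS w hw
  exact ⟨v, hv, by rw [LinearIsometryEquiv.trans_apply, hRw, hSv]⟩

/-- The key inequality: if every `|xᵢ| ≤ ‖x‖/√2` then `Σ|xᵢ|/2 ≥ ‖x‖/√2`. -/
theorem sum_abs_div_two_ge {x : E4} (h : ∀ i, |x i| ≤ ‖x‖ / Real.sqrt 2) :
    ‖x‖ / Real.sqrt 2 ≤ (|x 0| + |x 1| + |x 2| + |x 3|) / 2 := by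
  have hs : 0 < Real.sqrt 2 := by positivity
  have hs2 : Real.sqrt 2 ^ 2 = 2 := Real.sq_sqrt (by norm_num)
  have hn : 0 ≤ ‖x‖ := norm_nonneg x
  -- `xᵢ² ≤ |xᵢ| ‖x‖/√2`
  have hi : ∀ i, x i ^ 2 ≤ |x i| * (‖x‖ / Real.sqrt 2) := fun i => by
    rw [← sq_abs]; rw [sq]; exact mul_le_mul_of_nonneg_left (h i) (abs_nonneg _)
  have hsum : ‖x‖ ^ 2 ≤ (|x 0| + |x 1| + |x 2| + |x 3|) * (‖x‖ / Real.sqrt 2) := by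
    rw [EuclideanSpace.real_norm_sq_eq, Fin.sum_univ_four]
    nlinarith [hi 0, hi 1, hi 2, hi 3]
  by_cases hx : ‖x‖ = 0
  · rw [hx, zero_div]; positivity
  have hpos : 0 < ‖x‖ := lt_of_le_of_ne hn (Ne.symm hx)
  -- divide by `‖x‖/√2 > 0` and use `‖x‖ / (‖x‖/√2) = √2`, `√2 · (‖x‖/√2) … `
  have hq : 0 < ‖x‖ / Real.sqrt 2 := by positivity
  have h1 : ‖x‖ * Real.sqrt 2 ≤ |x 0| + |x 1| + |x 2| + |x 3| := by
    have := div_le_of_le_mul₀ hq.le (by positivity) hsum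
    rw [show ‖x‖ ^ 2 / (‖x‖ / Real.sqrt 2) = ‖x‖ * Real.sqrt 2 by field_simp] at this
    exact this
  rw [div_le_div_iff₀ hs (by norm_num : (0:ℝ) < 2)]
  nlinarith [hs2, h1]

/-- **R-B4d `ShortRootCovering`** BY NAME: the 24 short roots cover `S³` with angular radius `45°`. -/
theorem shortRootCovering_holds : ShortRootCovering := by
  intro x
  obtain ⟨i₀, -, hi₀⟩ := Finset.exists_max_image Finset.univ (fun i : Fin 4 => |x i|) ⟨0, Finset.mem_univ _⟩
  by_cases hbig : ‖x‖ / Real.sqrt 2 ≤ |x i₀|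
  · -- a coordinate transposition brings `x_{i₀}` to the time slot
    refine ⟨permIso (Equiv.swap 0 i₀), isD4Isometry_permIso _, ?_⟩
    rw [permIso_apply, Equiv.symm_swap, Equiv.swap_apply_left]
    exact hbig
  · -- all coordinates are `< ‖x‖/√2`: Hadamard ∘ signs
    have hall : ∀ i, |x i| ≤ ‖x‖ / Real.sqrt 2 := fun i =>
      (hi₀ i (Finset.mem_univ _)).trans (le_of_not_ge hbig)
    set s : Fin 4 → Bool := fun i => decide (0 ≤ x i) with hsdef
    refine ⟨(signIso s).trans hadIso, (isD4Isometry_signIso s).trans isD4Isometry_hadIso, ?_⟩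
    rw [LinearIsometryEquiv.trans_apply, hadIso_zero]
    have habs : ∀ i, (signIso s x) i = |x i| := by
      intro i
      rw [signIso_apply]
      simp only [hsdef, decide_eq_true_eq]
      split_ifs with h
      · rw [abs_of_nonneg h]
      · rw [abs_of_neg (lt_of_not_ge h)]
    rw [habs, habs, habs, habs, abs_of_nonneg (by positivity)]
    exact sum_abs_div_two_ge hall

end Summit.QuantumFields.YangMills.Theorems.F4SubCurvatureDoorFibreDichotomyAxis

end
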